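import Literature.Geometry.Kaehler.ComplexTorusMaximalCMSubfieldCenter
import Literature.Geometry.Kaehler.ComplexTorusVerySimpleFixedPointsEigenvalues
import HarnessLib

/-!
# A very simple `A^δ`: `ℚ[δ]` is its own centraliser in `End⁰(X)`, the centre of `End⁰(X)` is a CM
# subfield of `ℚ[δ]`, and for a Fermat prime `End(X) = ℤ[δ]` (Zarhin, Crelle 544 (2002), Thm. 5.2, torus level)

Layer `Literature/Geometry/Kaehler`, namespace `Literature.Geometry.Kaehler.ComplexTorus`; lane
`lit-hodgefound` (Track 2 foundations library), seat p11, generation 16, row g16-#3 — the ASSEMBLY of this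
seat's torus-level Zarhin programme. Sequel, BY NAME (nothing restated), of

* `ComplexTorusVerySimpleFixedPointsEigenvalues.lean` (g13-#3): `coe_centralizerEnd_eq_adjoin_of_hasEigenvalue_conj`
  — for `δ = D ∈ End(X)` with `Φ_p(D) = 0`, the fixed group `A^δ = fixedSubgroup Φ D ≅ 𝔽_p^r` a VERY
  SIMPLE `G`-module with the algebra `R = fixedImage Φ D p` of (2.19) normal for `G`, and an eigenvalue
  `μ` of `ρ_a(δ)` on `T₀X` with `μ̄` also an eigenvalue, the INTEGRAL centraliser is `End_δ(X) = ℤ[δ]`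
  (Dolgachev–Zarhin Thm. 2.18 + the eigenvalue obstruction of ZarhinCrelle Thm. 3.6);
* `ComplexTorusMaximalCMSubfieldCenter.lean` (g16-#2): ZarhinCrelle Thm. 3.8 at torus level —
  `exists_center_not_mem_maximalRealSubfield` (centre not totally real) and
  `endRingInt_le_adjoin_of_fermatPrime` (`End⁰(X) = ℚ[δ]`, `End(X) = ℤ[δ]` for a Fermat prime) from a
  RATIONALLY self-centralising `ℚ[δ]` and one multiplicity pair `mult(ν) ≠ mult(ν̄)`;
* `ComplexTorusCyclotomicAutomorphismFixedPoints.lean` (g7: `centralizerEnd`, `mem_centralizerEnd_iff`,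
  `pow_eq_one_of_aeval_cyclotomic`, `aeval_map_cyclotomic_eq_zero`), `ComplexTorusEndomorphismFieldEigenspaces.lean`
  (p13: `iInf_eigenspace_analyticRepHom_eq_eigenspace`, `eigenspace_analyticRepHom_eq_bot`).

THEOREMS ONLY (no definition, no named fact; net debt 0).

## Source, verbatim

Yu. G. Zarhin, *Cyclic covers of the projective line, their jacobians and endomorphisms*, J. reine angew.
Math. 544 (2002) (bib `Zarhin2002CyclicCovers`; held text `paper:arxiv-math_0008134`), §5, p0012:

"**Theorem 5.2.** Let `p` be an odd prime and `ζ ∈ K`. If the `Gal(f)`-module `(𝔽_p^{ℜ_f})^{00}` is very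
simple then `ℚ(δ_p)` coincides with its own centralizer in `End⁰(J^{(f,p)})` and the center of
`End⁰(J^{(f,p)})` is a CM-subfield of `ℚ(δ_p)`. In particular, if `p` is a Fermat prime then
`End⁰(J^{(f,p)}) = ℚ(δ_p)` and `End(J^{(f,p)}) = ℤ[δ_p]`. […] **Corollary 5.3.** Let `p` be an odd prime.
If `f(x) ∈ K[x]` is an irreducible polynomial of degree `n ≥ 5` and `Gal(f) = S_n` or `A_n` then `ℚ(δ_p)`
is a maximal commutative subalgebra in `End⁰(J^{(f,p)})` and the center of `End⁰(J^{(f,p)})` is a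
CM-subfield of `ℚ(δ_p)`. In particular, if `p` is a Fermat prime then `End⁰(J^{(f,p)}) = ℚ(δ_p)` and
`End(J^{(f,p)}) = ℤ[δ_p]`."; proof of Thm. 5.2 (p0012): "Since the `Gal(K)`-module `J^{(f,p)}(η)` is very
simple, either `R = 𝔽_p · I` or `R = End_{𝔽_p}(J^{(f,p)}(η))`. If `Λ/ηΛ = R = 𝔽_p · I` then `Λ` coincides
with `ℤ[δ_p]`. This means that `ℤ[δ_p]` coincides with its own centralizer in `End(J^{(f,p)})` and
therefore `ℚ(δ_p)` is a maximal commutative subalgebra in `End⁰(J^{(f,p)})`. If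
`Λ/ηΛ = R = End_{𝔽_p}(J^{(f,p)}(η))` then […] By Theorem 3.6, this cannot happen."

## Statement formalised (torus level) — an assembly

`X = E/Φ(ℤ^ι)` a complex torus of positive dimension, `η` a polarisation (`IsRiemannForm Φ η`),
`δ = D ∈ End(X) = endRingInt Φ` an integer matrix with `Φ_p(D) = 0`; the very-simplicity hypothesis in
g13's form (`IsNormalSubalgebra ρ (fixedImage Φ D p)`, `IsVerySimple ρ` for a representation `ρ` of a
group `G` on `A^δ`); and the two CURVE-SIDE eigenvalue inputs of the printed proofs, which are not
statements about the torus, as hypotheses exactly as g13-#3 and g16-#2 took them: an eigenvalue `μ` of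
`ρ_a(δ)` on `T₀X = Ω¹(X)^*` with `μ̄` an eigenvalue (Thm. 3.6's [Koo] input, `(p+1)/2` eigenvalues) and one
multiplicity pair `mult(ν) ≠ mult(ν̄)` (Thm. 3.8's [Koo] input).

* `mem_adjoin_of_commute_of_coe_centralizerEnd_eq_adjoin` — THE GLUE: `End_δ(X) = ℤ[δ]` (integral) ⟹
  every `B ∈ End⁰(X)` commuting with `δ` lies in `ℚ[δ]` ("`ℤ[δ_p]` coincides with its own centralizer in
  `End(J)` and therefore `ℚ(δ_p)` is a maximal commutative subalgebra in `End⁰(J)`": clear denominators,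
  `N·B ∈ End_δ(X)`).
* `mem_adjoin_of_commute_of_isVerySimple` — **Thm. 5.2, first clause** ("`ℚ(δ_p)` coincides with its own
  centralizer"), `p` any prime.
* `exists_center_not_mem_adjoin_of_isVerySimple` — **Thm. 5.2, middle clause** ("the center is a
  CM-subfield of `ℚ(δ_p)`"), `p` odd, in `δ`-language: a CENTRAL `c ∈ End⁰(X)` with `c ∈ ℚ[δ]` and
  `c ∉ ℚ[δ + δ⁻¹]`, the image of the maximal real subfield `ℚ(ζ_p + ζ_p⁻¹)` (under every embedding
  `ζ̄_p = ζ_p⁻¹`, so `ℚ[ζ_p + ζ_p⁻¹] ⊆ ℚ(ζ_p)⁺`); i.e. the centre, a subfield of `ℚ[δ] ≅ ℚ(ζ_p)`, is not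
  totally real. Reduced to g16-#2's Thm. 3.8 (i) along `ℚ(ζ_p) = CyclotomicField p ℚ → End⁰(X)`,
  `ζ_p ↦ δ` (`PowerBasis.lift`).
* `endRingInt_le_adjoin_of_isVerySimple_of_fermatPrime` — **Thm. 5.2, last clause** ("if `p` is a Fermat
  prime then `End⁰ = ℚ(δ_p)` and `End = ℤ[δ_p]`"): `p = 2^{2^r}+1`, every `B ∈ End⁰(X)` is a rational and
  every `U ∈ End(X)` an integer polynomial in `δ`.

Corollary 5.3 has, at torus level, literally the same content (its extra input "`Gal(f) = S_n` or
`A_n` ⟹ `(𝔽_p^{ℜ_f})^{00}` very simple" is Thm. 4.7, this seat's `PermutationModuleHeart*.lean` files,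
and enters through `IsVerySimple ρ`). NOT HERE: the curve, [Koo] Th. 3, Thm. 3.3 (`J(η) ≅ (𝔽_p^{ℜ_f})^{00}`).

## References

* [Zarhin2002CyclicCovers] Yu. G. Zarhin, J. reine angew. Math. 544 (2002), §5 Thm. 5.2, Cor. 5.3 and
  the proof of Thm. 5.2 (p0012); §3 Thm. 3.6, Thm. 3.8 (p0007–p0008).
* [DolgachevZarhin2024] I. Dolgachev, Yu. G. Zarhin, Endomorphisms of complex abelian varieties (2024),
  §2.2 Thm. 2.18 (through g13's files).
-/

noncomputable section

open Module Polynomial NumberField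
open scoped ComplexConjugate IntermediateField

namespace Literature.Geometry.Kaehler

namespace ComplexTorus

open Literature.RepresentationTheory

variable {ι : Type*} [Fintype ι] [DecidableEq ι] {E : Type*} [NormedAddCommGroup E] [NormedSpace ℂ E]
  (Φ : (ι → ℝ) ≃L[ℝ] E) {η : E [⋀^Fin 2]→L[ℝ] ℝ} {D : Matrix ι ι ℤ} {p : ℕ}

/-! ### §0 Plumbing: denominators, `ρ_a(δ)` in its two spellings, `f(P(δ)) = P(f(δ))` -/

omit [DecidableEq ι] in
/-- A rational matrix is `N⁻¹` times an integer matrix for some positive integer `N`. [folklore] -/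
private theorem exists_nat_smul_eq_map_intCast (q : Matrix ι ι ℚ) :
    ∃ N : ℕ, 0 < N ∧ ∃ A : Matrix ι ι ℤ, (N : ℚ) • q = A.map (Int.cast : ℤ → ℚ) := by
  refine ⟨∏ i, ∏ j, (q i j).den,
    Finset.prod_pos fun i _ => Finset.prod_pos fun j _ => (q i j).den_pos, ?_⟩
  have hdvd : ∀ i j, (q i j).den ∣ ∏ i, ∏ j, (q i j).den := fun i j =>
    (Finset.dvd_prod_of_mem (fun j => (q i j).den) (Finset.mem_univ j)).trans
      (Finset.dvd_prod_of_mem (fun i => ∏ j, (q i j).den) (Finset.mem_univ i))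
  have hint : ∀ i j, ∃ z : ℤ, ((∏ i, ∏ j, (q i j).den : ℕ) : ℚ) * q i j = z := fun i j => by
    obtain ⟨c, hc⟩ := hdvd i j
    refine ⟨c * (q i j).num, ?_⟩
    rw [hc, Nat.cast_mul, mul_comm ((q i j).den : ℚ), mul_assoc, Rat.den_mul_eq_num]
    push_cast
    ring
  choose z hz using hint
  refine ⟨Matrix.of fun i j => z i j, ?_⟩
  ext i j
  rw [Matrix.smul_apply, smul_eq_mul, hz, Matrix.map_apply, Matrix.of_apply]

omit [Fintype ι] [DecidableEq ι] in
/-- `(D_ℚ)_ℝ = D_ℝ`. [folklore] -/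
private theorem map_intCast_map_ratCast (D : Matrix ι ι ℤ) :
    (D.map (Int.cast : ℤ → ℚ)).map (Rat.cast : ℚ → ℝ) = D.map (Int.cast : ℤ → ℝ) := by
  ext i j
  simp

/-- `(P(D))_ℚ = P(D_ℚ)` for `P ∈ ℤ[t]`. [folklore] -/
private theorem map_aeval_intCast' (D : Matrix ι ι ℤ) (P : ℤ[X]) :
    (aeval D P).map (Int.cast : ℤ → ℚ) = aeval (D.map (Int.cast : ℤ → ℚ)) (P.map (Int.castRingHom ℚ)) := by
  have h := map_aeval_eq_aeval_map (S := Matrix ι ι ℤ) (U := Matrix ι ι ℚ) (φ := Int.castRingHom ℚ)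
    (ψ := (Int.castRingHom ℚ).mapMatrix) (RingHom.ext_int _ _) P D
  rw [RingHom.mapMatrix_apply, Int.coe_castRingHom] at h
  exact h

/-- The two spellings of `ρ_a(δ)` agree: `analyticRepHom Φ ⟨D_ℚ, _⟩ = analyticRep Φ Φ D_ℝ _`. [folklore] -/
private theorem coe_analyticRepHom_eq_analyticRep (hDq : D.map (Int.cast : ℤ → ℚ) ∈ endAlgRat Φ)
    (hB : D.map (Int.cast : ℤ → ℝ) * jMatrix Φ = jMatrix Φ * D.map (Int.cast : ℤ → ℝ)) :
    ((analyticRepHom Φ ⟨D.map (Int.cast : ℤ → ℚ), hDq⟩ : E →L[ℂ] E) : E →ₗ[ℂ] E) =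
      ((analyticRep Φ Φ (D.map (Int.cast : ℤ → ℝ)) hB : E →L[ℂ] E) : E →ₗ[ℂ] E) := by
  apply LinearMap.ext
  intro v
  change analyticRep Φ Φ ((D.map (Int.cast : ℤ → ℚ)).map (Rat.cast : ℚ → ℝ)) hDq v =
    analyticRep Φ Φ (D.map (Int.cast : ℤ → ℝ)) hB v
  rw [analyticRep_apply', analyticRep_apply', map_intCast_map_ratCast]

/-! ### §1 The glue: `End_δ(X) = ℤ[δ]` (integral) ⟹ `ℚ[δ]` is its own centraliser in `End⁰(X)` -/

/-- **"This means that `ℤ[δ_p]` coincides with its own centralizer in `End(J^{(f,p)})` and therefore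
`ℚ(δ_p)` is a maximal commutative subalgebra in `End⁰(J^{(f,p)})`"**: if the integral centraliser
`End_δ(X)` of `δ = D ∈ End(X)` is `ℤ[δ]`, then every element of `End⁰(X) = End(X) ⊗ ℚ` commuting with
`δ` is a rational polynomial in `δ` (clear denominators: `N·B ∈ End_δ(X) = ℤ[δ]`).
[cite: Zarhin2002CyclicCovers, §5 proof of Thm 5.2 (p0012)] -/
theorem mem_adjoin_of_commute_of_coe_centralizerEnd_eq_adjoin
    (h : (centralizerEnd Φ D : Set (Matrix ι ι ℤ)) = Algebra.adjoin ℤ ({D} : Set (Matrix ι ι ℤ)))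
    {B : Matrix ι ι ℚ} (hBe : B ∈ endAlgRat Φ)
    (hc : B * D.map (Int.cast : ℤ → ℚ) = D.map (Int.cast : ℤ → ℚ) * B) :
    B ∈ Algebra.adjoin ℚ ({D.map (Int.cast : ℤ → ℚ)} : Set (Matrix ι ι ℚ)) := by
  obtain ⟨N, hN, A, hA⟩ := exists_nat_smul_eq_map_intCast B
  -- `A = N·B` is an endomorphism commuting with `δ`
  have hAe : A ∈ endRingInt Φ := by
    rw [mem_endRingInt_iff, ← hA]
    exact Subalgebra.smul_mem (endAlgRat Φ) hBe (N : ℚ)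
  have hinj : Function.Injective ((Int.castRingHom ℚ).mapMatrix : Matrix ι ι ℤ →+* Matrix ι ι ℚ) :=
    fun X Y hXY ↦ Matrix.map_injective Int.cast_injective hXY
  have hAD : D * A = A * D := by
    apply hinj
    rw [map_mul, map_mul, RingHom.mapMatrix_apply, RingHom.mapMatrix_apply, Int.coe_castRingHom, ← hA,
      Matrix.mul_smul, Matrix.smul_mul, hc]
  have hAc : A ∈ (centralizerEnd Φ D : Set (Matrix ι ι ℤ)) := mem_centralizerEnd_iff.2 ⟨hAe, hAD⟩
  rw [h, SetLike.mem_coe, Algebra.adjoin_singleton_eq_range_aeval, AlgHom.mem_range] at hAc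
  obtain ⟨P, hP⟩ := hAc
  -- `B = N⁻¹ · P(δ)_ℚ`
  have hB : B = (N : ℚ)⁻¹ • aeval (D.map (Int.cast : ℤ → ℚ)) (P.map (Int.castRingHom ℚ)) := by
    rw [← map_aeval_intCast', hP, ← hA, smul_smul, inv_mul_cancel₀ (by exact_mod_cast hN.ne'), one_smul]
  rw [hB]
  exact Subalgebra.smul_mem _ (aeval_mem_adjoin_singleton ℚ _) _

/-! ### §2 Theorem 5.2 at torus level -/

section Theorem52

variable [FiniteDimensional ℂ E] [Module (ZMod p) (fixedSubgroup Φ D)]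

/-- **Theorem 5.2, first clause: "`ℚ(δ_p)` coincides with its own centralizer in `End⁰(J^{(f,p)})`."**
Torus level: `X = E/Φ(ℤ^ι)` of positive dimension, `p` prime, `δ = D ∈ End(X)` with `Φ_p(D) = 0`, the
`G`-module `A^δ` VERY SIMPLE with the algebra `R` of (2.19) normal for `G` (the torus form of "the
`Gal(K)`-module `J^{(f,p)}(η) = (𝔽_p^{ℜ_f})^{00}` is very simple"), and an eigenvalue `μ` of `ρ_a(δ)` on
`T₀X` whose conjugate `μ̄` is also an eigenvalue (the input of Thm. 3.6 — on the curve, [Koo]'s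
differentials; here a hypothesis as in `coe_centralizerEnd_eq_adjoin_of_hasEigenvalue_conj`). Then every
element of `End⁰(X)` commuting with `δ` lies in `ℚ[δ]`.
[cite: Zarhin2002CyclicCovers, §5 Thm 5.2 and its proof (p0012)] -/
theorem mem_adjoin_of_commute_of_isVerySimple [Nonempty ι] (hp : p.Prime)
    (hD : aeval D (cyclotomic p ℤ) = 0) (hDe : D ∈ endRingInt Φ) {G : Type*} [Group G]
    {ρ : Representation (ZMod p) G (fixedSubgroup Φ D)} (hnorm : IsNormalSubalgebra ρ (fixedImage Φ D p))
    (hvs : IsVerySimple ρ)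
    (hB : D.map (Int.cast : ℤ → ℝ) * jMatrix Φ = jMatrix Φ * D.map (Int.cast : ℤ → ℝ)) {μ : ℂ}
    (h₁ : Module.End.HasEigenvalue
      ((analyticRep Φ Φ (D.map (Int.cast : ℤ → ℝ)) hB : E →L[ℂ] E) : E →ₗ[ℂ] E) μ)
    (h₂ : Module.End.HasEigenvalue
      ((analyticRep Φ Φ (D.map (Int.cast : ℤ → ℝ)) hB : E →L[ℂ] E) : E →ₗ[ℂ] E) (conj μ)) :
    ∀ B ∈ endAlgRat Φ, B * D.map (Int.cast : ℤ → ℚ) = D.map (Int.cast : ℤ → ℚ) * B →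
      B ∈ Algebra.adjoin ℚ ({D.map (Int.cast : ℤ → ℚ)} : Set (Matrix ι ι ℚ)) :=
  fun _ hBe hc ↦ mem_adjoin_of_commute_of_coe_centralizerEnd_eq_adjoin Φ
    (coe_centralizerEnd_eq_adjoin_of_hasEigenvalue_conj Φ hp hD hDe hnorm hvs hB h₁ h₂) hBe hc

/-- **Theorem 5.2, last clause: "In particular, if `p` is a Fermat prime then
`End⁰(J^{(f,p)}) = ℚ(δ_p)` and `End(J^{(f,p)}) = ℤ[δ_p]`."** Torus level, for a POLARISED torus
`(X, η)`: under the hypotheses of `mem_adjoin_of_commute_of_isVerySimple` (very simple `A^δ`, an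
eigenvalue pair `μ, μ̄`), a Fermat prime `p = 2^{2^r} + 1`, and one eigenvalue `ν` of `ρ_a(δ)` with
`mult(ν) ≠ mult(ν̄)` (the input of Thm. 3.8 — [Koo], Th. 3 on the curve), every element of `End⁰(X)` is
a rational polynomial in `δ` and every element of `End(X)` an integer polynomial in `δ`
(`endRingInt_le_adjoin_of_fermatPrime` of this seat's `ComplexTorusMaximalCMSubfieldCenter.lean`).
Corollary 5.3 ("`Gal(f) = S_n` or `A_n`, `n ≥ 5`") has the same conclusion, its extra input being the
very simplicity of `(𝔽_p^{ℜ_f})^{00}` (Thm. 4.7, this seat's `PermutationModuleHeart*` files).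
[cite: Zarhin2002CyclicCovers, §5 Thm 5.2 and Cor 5.3 (p0012)] -/
theorem endRingInt_le_adjoin_of_isVerySimple_of_fermatPrime [Nonempty ι] (hp : p.Prime)
    (hF : ∃ r : ℕ, p = 2 ^ 2 ^ r + 1) (hη : IsRiemannForm Φ η)
    (hD : aeval D (cyclotomic p ℤ) = 0) (hDe : D ∈ endRingInt Φ) {G : Type*} [Group G]
    {ρ : Representation (ZMod p) G (fixedSubgroup Φ D)} (hnorm : IsNormalSubalgebra ρ (fixedImage Φ D p))
    (hvs : IsVerySimple ρ)
    (hB : D.map (Int.cast : ℤ → ℝ) * jMatrix Φ = jMatrix Φ * D.map (Int.cast : ℤ → ℝ)) {μ : ℂ}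
    (h₁ : Module.End.HasEigenvalue
      ((analyticRep Φ Φ (D.map (Int.cast : ℤ → ℝ)) hB : E →L[ℂ] E) : E →ₗ[ℂ] E) μ)
    (h₂ : Module.End.HasEigenvalue
      ((analyticRep Φ Φ (D.map (Int.cast : ℤ → ℝ)) hB : E →L[ℂ] E) : E →ₗ[ℂ] E) (conj μ))
    (hne : ∃ ν : ℂ,
      finrank ℂ ↥(Module.End.eigenspace
          ((analyticRep Φ Φ (D.map (Int.cast : ℤ → ℝ)) hB : E →L[ℂ] E) : E →ₗ[ℂ] E) ν) ≠
        finrank ℂ ↥(Module.End.eigenspace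
          ((analyticRep Φ Φ (D.map (Int.cast : ℤ → ℝ)) hB : E →L[ℂ] E) : E →ₗ[ℂ] E) (conj ν))) :
    (∀ B ∈ endAlgRat Φ, B ∈ Algebra.adjoin ℚ ({D.map (Int.cast : ℤ → ℚ)} : Set (Matrix ι ι ℚ))) ∧
      ∀ U ∈ endRingInt Φ, U ∈ Algebra.adjoin ℤ ({D} : Set (Matrix ι ι ℤ)) := by
  have hne' : ∃ ν : ℂ,
      finrank ℂ ↥(Module.End.eigenspace ((analyticRepHom Φ ⟨D.map (Int.cast : ℤ → ℚ),
          (mem_endRingInt_iff Φ).1 hDe⟩ : E →L[ℂ] E) : E →ₗ[ℂ] E) ν) ≠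
        finrank ℂ ↥(Module.End.eigenspace ((analyticRepHom Φ ⟨D.map (Int.cast : ℤ → ℚ),
          (mem_endRingInt_iff Φ).1 hDe⟩ : E →L[ℂ] E) : E →ₗ[ℂ] E) (conj ν)) := by
    rw [coe_analyticRepHom_eq_analyticRep Φ ((mem_endRingInt_iff Φ).1 hDe) hB]
    exact hne
  exact endRingInt_le_adjoin_of_fermatPrime Φ hp hF hη hD hDe
    (mem_adjoin_of_commute_of_isVerySimple Φ hp hD hDe hnorm hvs hB h₁ h₂) hne'

/-- **Theorem 5.2, middle clause: "the center of `End⁰(J^{(f,p)})` is a CM-subfield of `ℚ(δ_p)`."**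
Torus level, for a polarised `(X, η)` and an odd prime `p`: under the hypotheses of
`mem_adjoin_of_commute_of_isVerySimple` and one multiplicity pair `mult(ν) ≠ mult(ν̄)` of `ρ_a(δ)` (the
[Koo] input of Thm. 3.8), there is a CENTRAL element `c ∈ End⁰(X)`, lying in `ℚ[δ]` (which contains the
centre) but NOT in `ℚ[δ + δ⁻¹]` = the image of the maximal real subfield `ℚ(ζ_p + ζ_p⁻¹)` of
`ℚ(ζ_p) ≅ ℚ[δ]` (complex conjugation of `ℚ(ζ_p)` is `ζ_p ↦ ζ_p⁻¹` under every embedding). So the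
centre of `End⁰(X)`, a subfield of `ℚ[δ] ≅ ℚ(ζ_p)`, is not totally real: it is a CM subfield. Reduced to
this seat's `exists_center_not_mem_maximalRealSubfield` (Thm. 3.8 (i)) along the embedding
`ℚ(ζ_p) = CyclotomicField p ℚ → End⁰(X)`, `ζ_p ↦ δ`.
[cite: Zarhin2002CyclicCovers, §5 Thm 5.2 (p0012) and §3 Thm 3.8 (i) (p0008)] -/
theorem exists_center_not_mem_adjoin_of_isVerySimple [Nonempty ι] (hp : p.Prime) (hp2 : 2 < p)
    (hη : IsRiemannForm Φ η) (hD : aeval D (cyclotomic p ℤ) = 0) (hDe : D ∈ endRingInt Φ)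
    {G : Type*} [Group G] {ρ : Representation (ZMod p) G (fixedSubgroup Φ D)}
    (hnorm : IsNormalSubalgebra ρ (fixedImage Φ D p)) (hvs : IsVerySimple ρ)
    (hB : D.map (Int.cast : ℤ → ℝ) * jMatrix Φ = jMatrix Φ * D.map (Int.cast : ℤ → ℝ)) {μ : ℂ}
    (h₁ : Module.End.HasEigenvalue
      ((analyticRep Φ Φ (D.map (Int.cast : ℤ → ℝ)) hB : E →L[ℂ] E) : E →ₗ[ℂ] E) μ)
    (h₂ : Module.End.HasEigenvalue
      ((analyticRep Φ Φ (D.map (Int.cast : ℤ → ℝ)) hB : E →L[ℂ] E) : E →ₗ[ℂ] E) (conj μ))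
    (hne : ∃ ν : ℂ,
      finrank ℂ ↥(Module.End.eigenspace
          ((analyticRep Φ Φ (D.map (Int.cast : ℤ → ℝ)) hB : E →L[ℂ] E) : E →ₗ[ℂ] E) ν) ≠
        finrank ℂ ↥(Module.End.eigenspace
          ((analyticRep Φ Φ (D.map (Int.cast : ℤ → ℝ)) hB : E →L[ℂ] E) : E →ₗ[ℂ] E) (conj ν))) :
    ∃ c ∈ endAlgRat Φ, (∀ B ∈ endAlgRat Φ, B * c = c * B) ∧
      c ∈ Algebra.adjoin ℚ ({D.map (Int.cast : ℤ → ℚ)} : Set (Matrix ι ι ℚ)) ∧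
      c ∉ Algebra.adjoin ℚ ({D.map (Int.cast : ℤ → ℚ) + (D.map (Int.cast : ℤ → ℚ))⁻¹} :
        Set (Matrix ι ι ℚ)) := by
  classical
  haveI : Fact p.Prime := ⟨hp⟩
  haveI : NeZero p := ⟨hp.ne_zero⟩
  have hmax := mem_adjoin_of_commute_of_isVerySimple Φ hp hD hDe hnorm hvs hB h₁ h₂
  set Dq : Matrix ι ι ℚ := D.map (Int.cast : ℤ → ℚ) with hDqdef
  have hDq : Dq ∈ endAlgRat Φ := (mem_endRingInt_iff Φ).1 hDe
  have hDq0 : aeval Dq (cyclotomic p ℚ) = 0 := aeval_map_cyclotomic_eq_zero hD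
  have hDqp : Dq ^ p = 1 := by
    have h := congrArg ((Int.castRingHom ℚ).mapMatrix : Matrix ι ι ℤ →+* Matrix ι ι ℚ)
      (pow_eq_one_of_aeval_cyclotomic hD)
    rw [map_pow, map_one, RingHom.mapMatrix_apply, Int.coe_castRingHom] at h
    exact h
  -- the cyclotomic field `K = ℚ(ζ_p)` and its embedding `ζ ↦ δ`
  let K := CyclotomicField p ℚ
  haveI : IsCyclotomicExtension {p} ℚ K := CyclotomicField.isCyclotomicExtension p ℚ
  haveI : IsCMField K := IsCyclotomicExtension.Rat.isCMField K ⟨p, Set.mem_singleton p, hp2⟩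
  let ζ : K := IsCyclotomicExtension.zeta p ℚ K
  have hζ : IsPrimitiveRoot ζ p := IsCyclotomicExtension.zeta_spec p ℚ K
  have hmin : minpoly ℚ ζ = cyclotomic p ℚ := (cyclotomic_eq_minpoly_rat hζ hp.pos).symm
  let pb : PowerBasis ℚ K := hζ.powerBasis ℚ
  have hpb : pb.gen = ζ := IsPrimitiveRoot.powerBasis_gen ℚ hζ
  have hgen : aeval Dq (minpoly ℚ pb.gen) = 0 := by rw [hpb, hmin]; exact hDq0
  let f : K →ₐ[ℚ] Matrix ι ι ℚ := pb.lift Dq hgen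
  have hfζ : f ζ = Dq := by rw [← hpb]; exact pb.lift_gen Dq hgen
  have hrange : f.range = Algebra.adjoin ℚ ({Dq} : Set (Matrix ι ι ℚ)) := by
    rw [← Algebra.map_top, ← IsCyclotomicExtension.adjoin_primitive_root_eq_top hζ, AlgHom.map_adjoin,
      Set.image_singleton, hfζ]
  have hf : ∀ x, f x ∈ endAlgRat Φ := fun x ↦ by
    have hx : f x ∈ Algebra.adjoin ℚ ({Dq} : Set (Matrix ι ι ℚ)) := hrange ▸ f.mem_range_self x
    exact (Algebra.adjoin_le (Set.singleton_subset_iff.2 hDq) : _ ≤ endAlgRat Φ) hx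
  have hmax' : ∀ B ∈ endAlgRat Φ, (∀ k, B * f k = f k * B) → B ∈ Set.range f := fun B hB' hc ↦ by
    have h := hmax B hB' (by rw [← hfζ]; exact hc ζ)
    rw [← hrange, AlgHom.mem_range] at h
    exact h
  -- the multiplicity hypothesis on an embedding `σ` with `σ ζ = ν`
  have hζtop : ℚ⟮ζ⟯ = ⊤ :=
    (IntermediateField.adjoin_simple_eq_top_iff_of_isAlgebraic
      (Algebra.IsAlgebraic.isAlgebraic ζ)).2 (IsCyclotomicExtension.adjoin_primitive_root_eq_top hζ)
  have hne' : ∃ σ : K →+* ℂ,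
      finrank ℂ ↥(⨅ y : K, Module.End.eigenspace
          ((analyticRepHom Φ ⟨f y, hf y⟩ : E →L[ℂ] E) : E →ₗ[ℂ] E) (σ y)) ≠
        finrank ℂ ↥(⨅ y : K, Module.End.eigenspace
          ((analyticRepHom Φ ⟨f y, hf y⟩ : E →L[ℂ] E) : E →ₗ[ℂ] E)
            (NumberField.ComplexEmbedding.conjugate σ y)) := by
    obtain ⟨ν, hν⟩ := hne
    have hρ : ((analyticRep Φ Φ (D.map (Int.cast : ℤ → ℝ)) hB : E →L[ℂ] E) : E →ₗ[ℂ] E) =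
        ((analyticRepHom Φ ⟨f ζ, hf ζ⟩ : E →L[ℂ] E) : E →ₗ[ℂ] E) := by
      rw [← coe_analyticRepHom_eq_analyticRep Φ hDq hB]
      congr 2
      exact Subtype.ext hfζ.symm
    rw [hρ] at hν
    have hprim : IsPrimitiveRoot ν p := by
      by_contra hνp
      have hνp' : ¬ IsPrimitiveRoot (conj ν) p := fun h ↦ by
        have h' := h.map_of_injective (f := starRingEnd ℂ) (RingHom.injective _)
        rw [starRingEnd_self_apply] at h'
        exact hνp h'
      have hvan : ∀ ν' : ℂ, ¬ IsPrimitiveRoot ν' p →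
          Module.End.eigenspace ((analyticRepHom Φ ⟨f ζ, hf ζ⟩ : E →L[ℂ] E) : E →ₗ[ℂ] E) ν' = ⊥ := by
        intro ν' hν'
        refine eigenspace_analyticRepHom_eq_bot Φ f hf ζ ?_
        rw [hmin]
        intro h0
        apply hν'
        rwa [aeval_def, eval₂_eq_eval_map, map_cyclotomic, ← IsRoot.def, isRoot_cyclotomic_iff] at h0
      apply hν
      rw [hvan ν hνp, hvan (conj ν) hνp']
    have hgenν : aeval ν (minpoly ℚ pb.gen) = 0 := by
      rw [hpb, hmin, aeval_def, eval₂_eq_eval_map, map_cyclotomic, ← IsRoot.def, isRoot_cyclotomic_iff]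
      exact hprim
    let σ : K →ₐ[ℚ] ℂ := pb.lift ν hgenν
    have hσζ : σ ζ = ν := by rw [← hpb]; exact pb.lift_gen ν hgenν
    refine ⟨(σ : K →+* ℂ), ?_⟩
    rw [iInf_eigenspace_analyticRepHom_eq_eigenspace Φ f hf hζtop (σ : K →+* ℂ),
      iInf_eigenspace_analyticRepHom_eq_eigenspace Φ f hf hζtop
        (NumberField.ComplexEmbedding.conjugate (σ : K →+* ℂ)),
      NumberField.ComplexEmbedding.conjugate_coe_eq]
    change finrank ℂ ↥(Module.End.eigenspace _ (σ ζ)) ≠ finrank ℂ ↥(Module.End.eigenspace _ (conj (σ ζ)))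
    rw [hσζ]
    exact hν
  -- Theorem 3.8 (i): a central `f(k)` with `k ∉ K⁺`
  obtain ⟨k, hk, hkr⟩ := exists_center_not_mem_maximalRealSubfield Φ f hf hη hmax' hne'
  refine ⟨f k, hf k, hk, hrange ▸ f.mem_range_self k, fun hmem ↦ hkr ?_⟩
  -- `ℚ[δ + δ⁻¹] = f(ℚ[ζ + ζ⁻¹])`, and `ℚ[ζ + ζ⁻¹] ⊆ K⁺`
  have hζunit : ζ ^ p = 1 := hζ.pow_eq_one
  have hfinv : f (ζ ^ (p - 1)) = Dq⁻¹ := by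
    rw [map_pow, hfζ]
    symm
    apply Matrix.inv_eq_right_inv
    rw [← pow_succ', Nat.sub_add_cancel hp.one_lt.le, hDqp]
  have hζinv : ζ⁻¹ = ζ ^ (p - 1) := by
    symm
    rw [← mul_eq_one_iff_eq_inv₀ (hζ.ne_zero hp.ne_zero), ← pow_succ, Nat.sub_add_cancel hp.one_lt.le, hζunit]
  have hadj : Algebra.adjoin ℚ ({Dq + Dq⁻¹} : Set (Matrix ι ι ℚ)) =
      (Algebra.adjoin ℚ ({ζ + ζ⁻¹} : Set K)).map f := by
    rw [AlgHom.map_adjoin, Set.image_singleton, map_add, hfζ, hζinv, hfinv]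
  rw [hadj, Subalgebra.mem_map] at hmem
  obtain ⟨k', hk', hkk'⟩ := hmem
  have hkeq : k' = k := (f : K →+* Matrix ι ι ℚ).injective hkk'
  rw [← hkeq]
  -- `ℚ[ζ + ζ⁻¹]` consists of totally real elements
  refine Algebra.adjoin_induction (p := fun x _ ↦ x ∈ maximalRealSubfield K) (fun x hx ↦ ?_) (fun q ↦ ?_)
    (fun x y _ _ hx hy ↦ ?_) (fun x y _ _ hx hy ↦ ?_) hk'
  · rw [Set.mem_singleton_iff] at hx
    subst hx
    rw [mem_maximalRealSubfield_iff]
    intro φ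
    have hφζ : ‖φ ζ‖ = 1 := Complex.norm_eq_one_of_pow_eq_one (by rw [← map_pow, hζunit, map_one]) hp.ne_zero
    rw [map_add, map_inv₀, star_add, star_inv₀, RCLike.star_def, ← Complex.inv_eq_conj hφζ, inv_inv,
      add_comm]
  · rw [mem_maximalRealSubfield_iff]
    intro φ
    change star (φ ((q : ℚ) : K)) = φ ((q : ℚ) : K)
    rw [map_ratCast, RCLike.star_def, map_ratCast]
  · exact Subfield.add_mem _ hx hy
  · exact Subfield.mul_mem _ hx hy

end Theorem52

end ComplexTorus

end Literature.Geometry.Kaehler
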